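import Literature.Probability.Percolation.MarkedLoopTemperleyLiebCoords
import Literature.Probability.LatticeModels.TemperleyLiebLinkModule
import HarnessLib

/-!
# The periodic Temperley–Lieb generator at the closing edge `{*, 0}`, the polygon rotation on the planar module, and the mark rotation as Kauffman's generator («TL-PERIODIC-LINK»)

Topic `Literature/Probability/Percolation`; a rider on `MarkedLoopTemperleyLiebCoords.lean` («TRIPOD-TL-COORDS» / «TRIPOD-ROTINV»: `lpRot`, `lpCapRot`, `tlBraid`,
`solWLinkEquiv_solWRot`; ed. 2 `lpRotInv`, `lpCapPred`, `tlBraidInv`, `solWLinkEquiv_solWRot_symm`) and on `Literature/Probability/LatticeModels/TemperleyLiebLinkModule.lean`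
(`tlL δ j` — Pearce–Rittenberg–de Gier–Nienhuis's nearest-neighbour generators on the PLANAR module `LinkPattern (n+2) →₀ R` along the path `0 – 1 – ⋯ – (n+1)`, `lpVal`,
`lpVal_comp_tlL`, `isTemperleyLiebFamily_tlL`), using `TemperleyLiebGeneralLoopWeight.lean` (`tlGen_cubic`, `tlGen_cubic'`, `tlGen_comm_of_disjoint`, `tlGen_comm` for
ARBITRARY sites at every loop weight) and `TemperleyLiebBraid.lean` ed. 2 (`kauffmanGen`, `kauffman_mul_eq_one_of_one`).

The marked-loop lineage's link patterns live on a POLYGON (the `(k+1)`-gon `0, 1, …, k−1, *`), so besides the path generators `e_{j,j+1}` there is the generator at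
the CLOSING EDGE `{*, 0}` and the rotation `ρ` of the polygon — the periodic (affine) Temperley–Lieb setting. This file supplies, at every loop weight `δ`:

* `tlLcap δ` — THE GENERATOR AT THE CLOSING EDGE `{*, 0}` on `LinkPattern (n+2) →₀ R` (the bridge file's planar move `linkPatternCapLastZero`, with the loop factor),
  `tlLcap_single`, `lpVal_comp_tlLcap` (intertwined with `tlGen δ * 0` on all pairings);
* ★★ THE PERIODIC RELATIONS closing the Temperley–Lieb presentation around the polygon: `tlLcap_mul_tlLcap` (`e_{*0}² = δ e_{*0}`), `tlLcap_mul_tlL_zero_mul_tlLcap` /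
  `tlL_zero_mul_tlLcap_mul_tlL_zero` (`e_{*0} e_{01} e_{*0} = e_{*0}`, `e_{01} e_{*0} e_{01} = e_{01}`), `tlLcap_mul_tlL_last_mul_tlLcap` / `tlL_last_mul_tlLcap_mul_tlL_last`
  (the same with `e_{k−1,*}`), `tlLcap_comm_tlL` (`e_{*0}` commutes with the path generators away from `0` and `*`) — all pulled back from the arbitrary-site identities
  of `TemperleyLiebGeneralLoopWeight.lean` through the injective intertwiner `lpVal`;
* `lpRotL` / `lpRotInvL` — THE POLYGON ROTATION `ρ` AND ITS INVERSE ON THE PLANAR MODULE (`Finsupp.lmapDomain` of `lpRot` / `lpRotInv`), `lpRotL_mul_lpRotInvL` /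
  `lpRotInvL_mul_lpRotL`; ★★ THE ROTATION CONJUGATES THE GENERATORS CYCLICALLY: `lpRotL_mul_tlL_castSucc` (`ρ e_{j,j+1} = e_{j+1,j+2} ρ`), `lpRotL_mul_tlL_last`
  (`ρ e_{k−1,*} = e_{*,0} ρ`), `lpRotL_mul_tlLcap` (`ρ e_{*,0} = e_{0,1} ρ`) — with the underlying link-pattern identities `lpRot_connectSucc_castSucc`,
  `lpRot_connectSucc_last`, `lpRot_linkPatternCapLastZero`;
* `tlLper δ : Fin (n+2) → End` — the PERIODIC family (`e_0, …, e_n` along the path, `e_{n+1} = e_{*,0}`), `tlLper_castSucc` / `tlLper_last`;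
* ★★★ `tlBmod` := `kauffmanGen (tlLper 1) (−τ) (−τ²) (last) * lpRotL` — KAUFFMAN'S GENERATOR AT THE CLOSING EDGE COMPOSED WITH THE ROTATION, on the planar module at the
  percolation point — and ★★★ `tlBraid_eq_linearCombination_tlBmod` : **`tlBraid φ P = ⟪φ, tlBmod δ_P⟫`**: the lane's `tlBraid` (hence, by `solWLinkEquiv_solWRot`, the
  relabelling rotation of Khristoforov–Smirnov's `k` marks) IS THE TRANSPOSE OF `g_{*,0} ∘ ρ`, `g = A⁻¹·1 + A·e` (`A = −τ²`) — the identification asked for in the lineage's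
  design note (DESIGN-next-gen20 §3 item 1), now literally in terms of `kauffmanGen`; `tlBmodInv`, `tlBraidInv_eq_linearCombination_tlBmodInv` (the inverse: `A·1 + A⁻¹·e_{k−1,*}`
  after `ρ⁻¹`), and ★★ `tlBmod_mul_tlBmodInv` / `tlBmodInv_mul_tlBmod` — UNITARITY ON THE MODULE SIDE, obtained from `TemperleyLiebBraid`'s abstract `kauffman_mul_eq_one_of_one`
  after conjugating `e_{k−1,*}` into `e_{*,0}` by the rotation.
* ★ `linearCombination_tlBraid` / `tlBraid_pow_eq_linearCombination` (transposition extended linearly, all powers), ★★ `tlBmod_pow_marks` — THE FULL TWIST IS TRIVIAL ON THE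
  PLANAR MODULE (`tlBmod ^ k = 1`, the module-side twin of `tlBraid_pow_marks`), `tlBmodInv_eq_pow` (`tlBmodInv = tlBmod ^ (k−1)`).

## References
* M. Khristoforov, S. Smirnov, *Percolation and O(1) loop model*, arXiv:2111.15612 (2021), §1.2 (arXiv v1 p. 2: cyclic indexing of the marks), §2 Lemma 4 (p. 4).
* P. A. Pearce, V. Rittenberg, J. de Gier, B. Nienhuis, J. Phys. A 35 (2002) L661–L668, §2 ((TL), (monoid), link patterns).
* L. H. Kauffman, *Knots and Physics* (1991), Part I §7 (relations [𝒜]; `ρ(σᵢ) = A + A⁻¹Uᵢ`, `ρ(σᵢ⁻¹) = A⁻¹ + AUᵢ`; Prop. 7.5, proof step «First»).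

## Mathlib / tree
Tree: `MarkedLoopTemperleyLiebCoords.lean` (`lpRot`, `lpRot_val`, `lpCapRot`, `tlBraid_apply`, `lpRotInv`, `lpRot_lpRotInv`, `lpRotInv_lpRot`, `lpCapPred`, `tlBraidInv_apply`,
`lpRotInv_linkPatternCapLastZero`), `MarkedLoopTemperleyLieb.lean` (`linkPatternCapLastZero`, `pmRelabel_partner`, `connect_pmRelabel`, `isNonCrossing_connect_last_zero`),
`MarkedLoopBraidRotation.lean` (`rot_last`, `rot_castSucc_last`, `skeinA_mul_skeinAinv`, `skeinA_add_skeinAinv`), `LatticeModels/TemperleyLiebLinkModule.lean` (`tlL`, `tlL_single`,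
`lpVal`, `lpVal_single`, `lpVal_injective`, `lpVal_comp_tlL`, `LinkPattern.connectSucc`), `TemperleyLiebGeneralLoopWeight.lean` (`tlGen_single_eq`, `tlGen_comm`, `tlGen_cubic`,
`tlGen_cubic'`, `tlGen_comm_of_disjoint`), `TemperleyLiebLinkPatterns.lean` (`tlGen_comp_tlGen`), `TemperleyLiebBraid.lean` (`kauffmanGen`, `kauffmanGen_apply`,
`kauffman_mul_eq_one_of_one`). Mathlib: `Finsupp.lift`, `Finsupp.lmapDomain`, `Finsupp.linearCombination_single`, `Finsupp.lhom_ext`, `Module.End.mul_eq_comp`.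
-/

open Finset

namespace Literature.Probability.Percolation.MarkedLoops

open Literature.Probability.Percolation.FivePoint (tau)
open Literature.Probability.LatticeModels.TemperleyLieb

section Periodic

variable {n : ℕ}

/-! ### Rotation arithmetic on the labels -/

/-- `ρ (castSucc x) = x.succ` on `n + 2` labels (no wrap-around below the last label). [cite: KhristoforovSmirnov2021, §1.2 (arXiv v1 p. 2: cyclic indexing)] -/
theorem rot_castSucc_eq_succ (x : Fin (n + 1)) : rot (n + 1 + 1) (Fin.castSucc x) = x.succ := by
  apply Fin.ext
  rw [val_rot, Fin.val_castSucc, Fin.val_succ, if_neg (by have := x.2; omega)]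

/-- `ρ 0 = 1`. [cite: KhristoforovSmirnov2021, §1.2 (arXiv v1 p. 2: cyclic indexing)] -/
theorem rot_zero_eq_one : rot (n + 1 + 1) 0 = 1 := by
  have h := rot_castSucc_eq_succ (n := n) 0
  rwa [Fin.castSucc_zero, Fin.succ_zero_eq_one] at h

/-- `ρ⁻¹ (castSucc j.succ) = castSucc (castSucc j)`. [cite: KhristoforovSmirnov2021, §1.2 (arXiv v1 p. 2: cyclic indexing)] -/
theorem rot_symm_castSucc_succ (j : Fin n) : (rot (n + 1 + 1)).symm (Fin.castSucc j.succ) = Fin.castSucc (Fin.castSucc j) := by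
  rw [Equiv.symm_apply_eq, rot_castSucc_eq_succ, Fin.succ_castSucc]

/-- `ρ⁻¹ * = k−1` (`*` = the last label). [cite: KhristoforovSmirnov2021, §1.2 (arXiv v1 p. 2: cyclic indexing)] -/
theorem rot_symm_last : (rot (n + 1 + 1)).symm (Fin.last (n + 1)) = Fin.castSucc (Fin.last n) := by
  rw [Equiv.symm_apply_eq, rot_castSucc_last]

/-- `ρ⁻¹ 1 = 0`. [cite: KhristoforovSmirnov2021, §1.2 (arXiv v1 p. 2: cyclic indexing)] -/
theorem rot_symm_one : (rot (n + 1 + 1)).symm 1 = 0 := by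
  rw [Equiv.symm_apply_eq, rot_zero_eq_one]

/-! ### The rotation carries each edge of the polygon to the next -/

/-- ★ `ρ (e_{j,j+1} P) = e_{j+1,j+2} (ρ P)` on link patterns (`j + 2 ≤ n + 1`). [cite: PearceRittenbergDeGierNienhuis2002, §2 (monoid); KhristoforovSmirnov2021, §1.2 (arXiv v1 p. 2)] -/
theorem lpRot_connectSucc_castSucc (P : LinkPattern (n + 1 + 1)) (j : Fin n) :
    lpRot (P.connectSucc (Fin.castSucc j)) = (lpRot P).connectSucc j.succ := by
  apply Subtype.ext
  rw [lpRot_val, LinkPattern.connectSucc_val, LinkPattern.connectSucc_val, lpRot_val, ← connect_pmRelabel, rot_castSucc_eq_succ, Fin.succ_castSucc,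
    rot_castSucc_eq_succ]

/-- ★ `ρ (e_{k−1,*} P) = e_{*,0} (ρ P)`. [cite: PearceRittenbergDeGierNienhuis2002, §2 (monoid); KhristoforovSmirnov2021, §1.2 (arXiv v1 p. 2)] -/
theorem lpRot_connectSucc_last (P : LinkPattern (n + 1 + 1)) : lpRot (P.connectSucc (Fin.last n)) = linkPatternCapLastZero (lpRot P) :=
  lpRot_lpCapPred P

/-- ★ `ρ (e_{*,0} P) = e_{0,1} (ρ P)`. [cite: PearceRittenbergDeGierNienhuis2002, §2 (monoid); KhristoforovSmirnov2021, §1.2 (arXiv v1 p. 2)] -/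
theorem lpRot_linkPatternCapLastZero (P : LinkPattern (n + 1 + 1)) : lpRot (linkPatternCapLastZero P) = (lpRot P).connectSucc 0 := by
  apply Subtype.ext
  rw [lpRot_val, LinkPattern.connectSucc_val, lpRot_val, show (linkPatternCapLastZero P).1 = P.1.connect (Fin.last (n + 1)) 0 from rfl, ← connect_pmRelabel,
    rot_last, Fin.castSucc_zero, Fin.succ_zero_eq_one, rot_zero_eq_one]

/-! ### The generator at the closing edge and the periodic relations -/

section Module

variable (R : Type*) [CommRing R]

/-- **the Temperley–Lieb generator at the CLOSING EDGE `{*, 0}` of the polygon, with loop weight `δ`, on the planar module** `LinkPattern (n+2) →₀ R`: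
`δ_P ↦ δ • δ_P` if `P` pairs `*` with `0`, else `δ_P ↦ δ_{e_{*,0} P}` (the bridge file's planar move `linkPatternCapLastZero`).
[cite: PearceRittenbergDeGierNienhuis2002, §2 (TL), (monoid); KhristoforovSmirnov2021, §1.2 (arXiv v1 p. 2: cyclic indexing)] -/
noncomputable def tlLcap (δ : R) : (LinkPattern (n + 1 + 1) →₀ R) →ₗ[R] (LinkPattern (n + 1 + 1) →₀ R) :=
  Finsupp.lift (LinkPattern (n + 1 + 1) →₀ R) R (LinkPattern (n + 1 + 1)) fun P =>
    if P.1.partner (Fin.last (n + 1)) = 0 then δ • Finsupp.single P 1 else Finsupp.single (linkPatternCapLastZero P) 1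

variable {R}

/-- if `P` pairs `*` with `0`, capping does nothing. [cite: PearceRittenbergDeGierNienhuis2002, §2 (monoid)] -/
theorem linkPatternCapLastZero_of_partner_eq (P : LinkPattern (n + 1 + 1)) (h : P.1.partner (Fin.last (n + 1)) = 0) : linkPatternCapLastZero P = P :=
  Subtype.ext (PerfectMatching.connect_of_partner_eq P.1 h)

/-- the closing-edge generator on a basis vector, in one formula. [cite: PearceRittenbergDeGierNienhuis2002, §2 (TL), (monoid)] -/
theorem tlLcap_single (δ : R) (P : LinkPattern (n + 1 + 1)) (c : R) :
    tlLcap R δ (Finsupp.single P c) = (if P.1.partner (Fin.last (n + 1)) = 0 then δ else 1) • Finsupp.single (linkPatternCapLastZero P) c := by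
  simp only [tlLcap, Finsupp.lift_apply, Finsupp.sum_single_index, zero_smul]
  split_ifs with h
  · rw [linkPatternCapLastZero_of_partner_eq P h, ← Finsupp.smul_single_one P c, smul_comm]
  · rw [one_smul, Finsupp.smul_single_one]

variable (R)

/-- ★ the embedding into all pairings intertwines the closing-edge generator with `tlGen δ * 0`. [cite: PearceRittenbergDeGierNienhuis2002, §2 (TL), (monoid)] -/
theorem lpVal_comp_tlLcap (δ : R) : lpVal R ∘ₗ tlLcap R δ = tlGen R δ (Fin.last (n + 1)) 0 ∘ₗ lpVal (n := n) R := by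
  refine Finsupp.lhom_ext fun P c => ?_
  rw [LinearMap.comp_apply, LinearMap.comp_apply, tlLcap_single, map_smul, lpVal_single, lpVal_single, tlGen_single_eq]
  rfl

variable {R}

/-- composites of intertwined operators are intertwined. [folklore] -/
private theorem comp_mul_per {V W : Type*} [AddCommGroup V] [Module R V] [AddCommGroup W] [Module R W] (ι : V →ₗ[R] W)
    {f g : Module.End R V} {e e' : Module.End R W} (hf : ι ∘ₗ f = e ∘ₗ ι) (hg : ι ∘ₗ g = e' ∘ₗ ι) : ι ∘ₗ (f * g) = (e * e') ∘ₗ ι := by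
  rw [Module.End.mul_eq_comp, Module.End.mul_eq_comp, ← LinearMap.comp_assoc, hf, LinearMap.comp_assoc, hg, ← LinearMap.comp_assoc]

/-- an injective intertwiner reflects equalities. [folklore] -/
private theorem eq_of_comp_eq_per {V W : Type*} [AddCommGroup V] [Module R V] [AddCommGroup W] [Module R W] {ι : V →ₗ[R] W} (hι : Function.Injective ι)
    {f g : Module.End R V} (h : ι ∘ₗ f = ι ∘ₗ g) : f = g :=
  LinearMap.ext fun v => hι (by rw [← LinearMap.comp_apply, h, LinearMap.comp_apply])

/-- `*` is not `0`. [cite: KhristoforovSmirnov2021, §1.2 (arXiv v1 p. 2)] -/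
private theorem last_ne_zero' : (Fin.last (n + 1) : Fin (n + 1 + 1)) ≠ 0 := fun e => by
  have := congrArg Fin.val e; rw [Fin.val_last, Fin.val_zero] at this; omega

variable (R)

/-- ★★ `e_{*,0}² = δ e_{*,0}` on the planar module. [cite: PearceRittenbergDeGierNienhuis2002, §2 (TL)] -/
theorem tlLcap_mul_tlLcap (δ : R) : tlLcap (n := n) R δ * tlLcap R δ = δ • tlLcap R δ := by
  apply eq_of_comp_eq_per (lpVal_injective R)
  rw [comp_mul_per _ (lpVal_comp_tlLcap R δ) (lpVal_comp_tlLcap R δ), Module.End.mul_eq_comp, tlGen_comp_tlGen δ last_ne_zero', LinearMap.smul_comp,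
    LinearMap.comp_smul, lpVal_comp_tlLcap]

/-- ★★ **the periodic cubic relation at the corner `0`**: `e_{*,0} e_{0,1} e_{*,0} = e_{*,0}` (`k ≥ 2`, i.e. `0 < n`). [cite: PearceRittenbergDeGierNienhuis2002, §2 (TL); Kauffman1991KnotsPhysics, Part I §7 relations [𝒜]] -/
theorem tlLcap_mul_tlL_zero_mul_tlLcap (δ : R) (hn : 0 < n) : tlLcap (n := n) R δ * tlL R δ 0 * tlLcap R δ = tlLcap R δ := by
  have hac : (Fin.last (n + 1) : Fin (n + 1 + 1)) ≠ (0 : Fin (n + 1)).succ := fun e => by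
    have := congrArg Fin.val e; rw [Fin.val_last, Fin.val_succ, Fin.val_zero] at this; omega
  apply eq_of_comp_eq_per (lpVal_injective R)
  rw [comp_mul_per _ (comp_mul_per _ (lpVal_comp_tlLcap R δ) (lpVal_comp_tlL R δ 0)) (lpVal_comp_tlLcap R δ), lpVal_comp_tlLcap]
  congr 1
  show tlGen R δ _ _ * tlGen R δ (Fin.castSucc 0) _ * tlGen R δ _ _ = _
  rw [Fin.castSucc_zero]
  exact tlGen_cubic R δ last_ne_zero' (Fin.succ_ne_zero 0).symm hac

/-- ★★ `e_{0,1} e_{*,0} e_{0,1} = e_{0,1}` (`0 < n`). [cite: PearceRittenbergDeGierNienhuis2002, §2 (TL); Kauffman1991KnotsPhysics, Part I §7 relations [𝒜]] -/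
theorem tlL_zero_mul_tlLcap_mul_tlL_zero (δ : R) (hn : 0 < n) : tlL R δ 0 * tlLcap (n := n) R δ * tlL R δ 0 = tlL R δ 0 := by
  have hac : (Fin.last (n + 1) : Fin (n + 1 + 1)) ≠ (0 : Fin (n + 1)).succ := fun e => by
    have := congrArg Fin.val e; rw [Fin.val_last, Fin.val_succ, Fin.val_zero] at this; omega
  apply eq_of_comp_eq_per (lpVal_injective R)
  rw [comp_mul_per _ (comp_mul_per _ (lpVal_comp_tlL R δ 0) (lpVal_comp_tlLcap R δ)) (lpVal_comp_tlL R δ 0), lpVal_comp_tlL]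
  congr 1
  show tlGen R δ (Fin.castSucc 0) _ * tlGen R δ _ _ * tlGen R δ (Fin.castSucc 0) _ = tlGen R δ (Fin.castSucc 0) _
  rw [Fin.castSucc_zero]
  exact tlGen_cubic' R δ last_ne_zero' (Fin.succ_ne_zero 0).symm hac

/-- ★★ **the periodic cubic relation at the corner `*`**: `e_{*,0} e_{k−1,*} e_{*,0} = e_{*,0}` (`0 < n`). [cite: PearceRittenbergDeGierNienhuis2002, §2 (TL); Kauffman1991KnotsPhysics, Part I §7 relations [𝒜]] -/
theorem tlLcap_mul_tlL_last_mul_tlLcap (δ : R) (hn : 0 < n) : tlLcap (n := n) R δ * tlL R δ (Fin.last n) * tlLcap R δ = tlLcap R δ := by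
  have hbc : (Fin.last (n + 1) : Fin (n + 1 + 1)) ≠ Fin.castSucc (Fin.last n) := fun e => by
    have := congrArg Fin.val e; rw [Fin.val_last, Fin.val_castSucc, Fin.val_last] at this; omega
  have hac : (0 : Fin (n + 1 + 1)) ≠ Fin.castSucc (Fin.last n) := fun e => by
    have := congrArg Fin.val e; rw [Fin.val_zero, Fin.val_castSucc, Fin.val_last] at this; omega
  apply eq_of_comp_eq_per (lpVal_injective R)
  rw [comp_mul_per _ (comp_mul_per _ (lpVal_comp_tlLcap R δ) (lpVal_comp_tlL R δ (Fin.last n))) (lpVal_comp_tlLcap R δ), lpVal_comp_tlLcap]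
  congr 1
  show tlGen R δ _ _ * tlGen R δ (Fin.castSucc (Fin.last n)) (Fin.last n).succ * tlGen R δ _ _ = _
  rw [Fin.succ_last, tlGen_comm R δ (Fin.last (n + 1)) 0, tlGen_comm R δ (Fin.castSucc (Fin.last n)) (Fin.last (n + 1))]
  exact tlGen_cubic R δ last_ne_zero'.symm hbc hac

/-- ★★ `e_{k−1,*} e_{*,0} e_{k−1,*} = e_{k−1,*}` (`0 < n`). [cite: PearceRittenbergDeGierNienhuis2002, §2 (TL); Kauffman1991KnotsPhysics, Part I §7 relations [𝒜]] -/
theorem tlL_last_mul_tlLcap_mul_tlL_last (δ : R) (hn : 0 < n) : tlL R δ (Fin.last n) * tlLcap (n := n) R δ * tlL R δ (Fin.last n) = tlL R δ (Fin.last n) := by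
  have hbc : (Fin.last (n + 1) : Fin (n + 1 + 1)) ≠ Fin.castSucc (Fin.last n) := fun e => by
    have := congrArg Fin.val e; rw [Fin.val_last, Fin.val_castSucc, Fin.val_last] at this; omega
  have hac : (0 : Fin (n + 1 + 1)) ≠ Fin.castSucc (Fin.last n) := fun e => by
    have := congrArg Fin.val e; rw [Fin.val_zero, Fin.val_castSucc, Fin.val_last] at this; omega
  apply eq_of_comp_eq_per (lpVal_injective R)
  rw [comp_mul_per _ (comp_mul_per _ (lpVal_comp_tlL R δ (Fin.last n)) (lpVal_comp_tlLcap R δ)) (lpVal_comp_tlL R δ (Fin.last n)), lpVal_comp_tlL]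
  congr 1
  show tlGen R δ (Fin.castSucc (Fin.last n)) (Fin.last n).succ * tlGen R δ _ _ * tlGen R δ (Fin.castSucc (Fin.last n)) (Fin.last n).succ =
    tlGen R δ (Fin.castSucc (Fin.last n)) (Fin.last n).succ
  rw [Fin.succ_last, tlGen_comm R δ (Fin.last (n + 1)) 0, tlGen_comm R δ (Fin.castSucc (Fin.last n)) (Fin.last (n + 1))]
  exact tlGen_cubic' R δ last_ne_zero'.symm hbc hac

/-- ★ `e_{*,0}` commutes with the path generators `e_{j,j+1}` for `0 < j < k−1` (edges disjoint from `{*, 0}`). [cite: PearceRittenbergDeGierNienhuis2002, §2 (TL); Kauffman1991KnotsPhysics, Part I §7 relations [𝒜]] -/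
theorem tlLcap_comm_tlL (δ : R) (j : Fin (n + 1)) (h0 : 0 < j.val) (h1 : j.val < n) : tlLcap (n := n) R δ * tlL R δ j = tlL R δ j * tlLcap R δ := by
  have h₁ : (Fin.last (n + 1) : Fin (n + 1 + 1)) ≠ Fin.castSucc j := fun e => by have := congrArg Fin.val e; rw [Fin.val_last, Fin.val_castSucc] at this; omega
  have h₂ : (Fin.last (n + 1) : Fin (n + 1 + 1)) ≠ j.succ := fun e => by have := congrArg Fin.val e; rw [Fin.val_last, Fin.val_succ] at this; omega
  have h₃ : (0 : Fin (n + 1 + 1)) ≠ Fin.castSucc j := fun e => by have := congrArg Fin.val e; rw [Fin.val_zero, Fin.val_castSucc] at this; omega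
  have h₄ : (0 : Fin (n + 1 + 1)) ≠ j.succ := fun e => by have := congrArg Fin.val e; rw [Fin.val_zero, Fin.val_succ] at this; omega
  apply eq_of_comp_eq_per (lpVal_injective R)
  rw [comp_mul_per _ (lpVal_comp_tlLcap R δ) (lpVal_comp_tlL R δ j), comp_mul_per _ (lpVal_comp_tlL R δ j) (lpVal_comp_tlLcap R δ)]
  congr 1
  exact tlGen_comm_of_disjoint R δ last_ne_zero' (Fin.castSucc_lt_succ (i := j)).ne h₁ h₂ h₃ h₄

/-! ### The rotation on the planar module conjugates the generators cyclically -/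

/-- **the polygon rotation on the planar module** (`δ_P ↦ δ_{ρP}`). [cite: KhristoforovSmirnov2021, §1.2 (arXiv v1 p. 2: cyclic indexing)] -/
noncomputable def lpRotL : (LinkPattern (n + 1 + 1) →₀ R) →ₗ[R] (LinkPattern (n + 1 + 1) →₀ R) :=
  Finsupp.lmapDomain R R (lpRot : LinkPattern (n + 1 + 1) → LinkPattern (n + 1 + 1))

/-- **the inverse polygon rotation on the planar module** (`δ_P ↦ δ_{ρ⁻¹P}`). [cite: KhristoforovSmirnov2021, §1.2 (arXiv v1 p. 2: cyclic indexing)] -/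
noncomputable def lpRotInvL : (LinkPattern (n + 1 + 1) →₀ R) →ₗ[R] (LinkPattern (n + 1 + 1) →₀ R) :=
  Finsupp.lmapDomain R R (lpRotInv : LinkPattern (n + 1 + 1) → LinkPattern (n + 1 + 1))

variable {R}

/-- the rotation on a basis vector. [cite: KhristoforovSmirnov2021, §1.2 (arXiv v1 p. 2)] -/
theorem lpRotL_single (P : LinkPattern (n + 1 + 1)) (c : R) : lpRotL R (Finsupp.single P c) = Finsupp.single (lpRot P) c := by
  rw [lpRotL, Finsupp.lmapDomain_apply, Finsupp.mapDomain_single]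

/-- the inverse rotation on a basis vector. [cite: KhristoforovSmirnov2021, §1.2 (arXiv v1 p. 2)] -/
theorem lpRotInvL_single (P : LinkPattern (n + 1 + 1)) (c : R) : lpRotInvL R (Finsupp.single P c) = Finsupp.single (lpRotInv P) c := by
  rw [lpRotInvL, Finsupp.lmapDomain_apply, Finsupp.mapDomain_single]

variable (R)

/-- `ρ ρ⁻¹ = 1` on the module. [cite: KhristoforovSmirnov2021, §1.2 (arXiv v1 p. 2: cyclic indexing)] -/
theorem lpRotL_mul_lpRotInvL : lpRotL (n := n) R * lpRotInvL R = 1 := by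
  refine Finsupp.lhom_ext fun P c => ?_
  rw [Module.End.mul_apply, lpRotInvL_single, lpRotL_single, lpRot_lpRotInv, Module.End.one_apply]

/-- `ρ⁻¹ ρ = 1` on the module. [cite: KhristoforovSmirnov2021, §1.2 (arXiv v1 p. 2: cyclic indexing)] -/
theorem lpRotInvL_mul_lpRotL : lpRotInvL (n := n) R * lpRotL R = 1 := by
  refine Finsupp.lhom_ext fun P c => ?_
  rw [Module.End.mul_apply, lpRotL_single, lpRotInvL_single, lpRotInv_lpRot, Module.End.one_apply]

/-- the loop condition is transported by the rotation: `ρP` pairs `j+1` with `j+2` iff `P` pairs `j` with `j+1`. [cite: KhristoforovSmirnov2021, §1.2 (arXiv v1 p. 2); PearceRittenbergDeGierNienhuis2002, §2] -/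
theorem lpRot_partner_castSucc_succ_iff (P : LinkPattern (n + 1 + 1)) (j : Fin n) :
    (lpRot P).1.partner (Fin.castSucc j.succ) = j.succ.succ ↔ P.1.partner (Fin.castSucc (Fin.castSucc j)) = (Fin.castSucc j).succ := by
  rw [lpRot_val, pmRelabel_partner, rot_symm_castSucc_succ,
    show j.succ.succ = rot (n + 1 + 1) (Fin.castSucc j).succ by rw [Fin.succ_castSucc, rot_castSucc_eq_succ], Equiv.apply_eq_iff_eq]

/-- `ρP` pairs `*` with `0` iff `P` pairs `k−1` with `*`. [cite: KhristoforovSmirnov2021, §1.2 (arXiv v1 p. 2); PearceRittenbergDeGierNienhuis2002, §2] -/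
theorem lpRot_partner_last_iff (P : LinkPattern (n + 1 + 1)) :
    (lpRot P).1.partner (Fin.last (n + 1)) = 0 ↔ P.1.partner (Fin.castSucc (Fin.last n)) = (Fin.last n).succ := by
  rw [lpRot_val, pmRelabel_partner, rot_symm_last, show (0 : Fin (n + 1 + 1)) = rot (n + 1 + 1) (Fin.last n).succ by rw [Fin.succ_last, rot_last],
    Equiv.apply_eq_iff_eq]

/-- `ρP` pairs `0` with `1` iff `P` pairs `*` with `0`. [cite: KhristoforovSmirnov2021, §1.2 (arXiv v1 p. 2); PearceRittenbergDeGierNienhuis2002, §2] -/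
theorem lpRot_partner_zero_iff (P : LinkPattern (n + 1 + 1)) :
    (lpRot P).1.partner (Fin.castSucc 0) = (0 : Fin (n + 1)).succ ↔ P.1.partner (Fin.last (n + 1)) = 0 := by
  have h0 : (rot (n + 1 + 1)).symm 0 = Fin.last (n + 1) := by rw [Equiv.symm_apply_eq, rot_last]
  rw [lpRot_val, pmRelabel_partner, Fin.castSucc_zero, h0, Fin.succ_zero_eq_one, show (1 : Fin (n + 1 + 1)) = rot (n + 1 + 1) 0 from rot_zero_eq_one.symm,
    Equiv.apply_eq_iff_eq]

/-- ★★ **THE ROTATION CARRIES `e_{j,j+1}` TO `e_{j+1,j+2}`**: `ρ ∘ e_{j,j+1} = e_{j+1,j+2} ∘ ρ` on the planar module (`j + 2 ≤ n + 1`).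
[cite: PearceRittenbergDeGierNienhuis2002, §2 (TL); KhristoforovSmirnov2021, §1.2 (arXiv v1 p. 2: cyclic indexing)] -/
theorem lpRotL_mul_tlL_castSucc (δ : R) (j : Fin n) : lpRotL (n := n) R * tlL R δ (Fin.castSucc j) = tlL R δ j.succ * lpRotL R := by
  refine Finsupp.lhom_ext fun P c => ?_
  rw [Module.End.mul_apply, Module.End.mul_apply, tlL_single, map_smul, lpRotL_single, lpRotL_single, tlL_single, lpRot_connectSucc_castSucc]
  simp only [lpRot_partner_castSucc_succ_iff]

/-- ★★ **THE ROTATION CARRIES `e_{k−1,*}` TO THE CLOSING-EDGE GENERATOR**: `ρ ∘ e_{k−1,*} = e_{*,0} ∘ ρ`. [cite: PearceRittenbergDeGierNienhuis2002, §2 (TL); KhristoforovSmirnov2021, §1.2 (arXiv v1 p. 2)] -/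
theorem lpRotL_mul_tlL_last (δ : R) : lpRotL (n := n) R * tlL R δ (Fin.last n) = tlLcap R δ * lpRotL R := by
  refine Finsupp.lhom_ext fun P c => ?_
  rw [Module.End.mul_apply, Module.End.mul_apply, tlL_single, map_smul, lpRotL_single, lpRotL_single, tlLcap_single, lpRot_connectSucc_last]
  simp only [lpRot_partner_last_iff]

/-- ★★ **THE ROTATION CARRIES THE CLOSING-EDGE GENERATOR TO `e_{0,1}`**: `ρ ∘ e_{*,0} = e_{0,1} ∘ ρ`. [cite: PearceRittenbergDeGierNienhuis2002, §2 (TL); KhristoforovSmirnov2021, §1.2 (arXiv v1 p. 2)] -/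
theorem lpRotL_mul_tlLcap (δ : R) : lpRotL (n := n) R * tlLcap R δ = tlL R δ 0 * lpRotL R := by
  refine Finsupp.lhom_ext fun P c => ?_
  rw [Module.End.mul_apply, Module.End.mul_apply, tlLcap_single, map_smul, lpRotL_single, lpRotL_single, tlL_single, lpRot_linkPatternCapLastZero]
  simp only [lpRot_partner_zero_iff]

/-- **the PERIODIC family of generators** `e_0, …, e_n` (path edges) and `e_{n+1} = e_{*,0}` (the closing edge), indexed by `Fin (n+2)`.
[cite: PearceRittenbergDeGierNienhuis2002, §2 (TL); KhristoforovSmirnov2021, §1.2 (arXiv v1 p. 2: cyclic indexing)] -/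
noncomputable def tlLper (δ : R) (i : Fin (n + 1 + 1)) : Module.End R (LinkPattern (n + 1 + 1) →₀ R) :=
  Fin.lastCases (tlLcap R δ) (fun j => tlL R δ j) i

/-- the periodic family at a path edge. [cite: PearceRittenbergDeGierNienhuis2002, §2 (TL)] -/
theorem tlLper_castSucc (δ : R) (j : Fin (n + 1)) : tlLper (n := n) R δ (Fin.castSucc j) = tlL R δ j := by
  rw [tlLper, Fin.lastCases_castSucc]

/-- the periodic family at the closing edge. [cite: PearceRittenbergDeGierNienhuis2002, §2 (TL)] -/
theorem tlLper_last (δ : R) : tlLper (n := n) R δ (Fin.last (n + 1)) = tlLcap R δ := by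
  rw [tlLper, Fin.lastCases_last]

end Module

/-! ### The mark rotation is Kauffman's generator at the closing edge composed with the polygon rotation -/

section Braid

/-- `(−τ)(−τ²) = 1` and Kauffman's criterion `u² + uv + v² = 0` for `(u, v) = (−τ, −τ²)`. [cite: KhristoforovSmirnov2021, §2 Definition 3 (arXiv v1 p. 4: τ = e^{2πi/3})] -/
private theorem tau_criterion : (-tau) * (-tau ^ 2) = 1 ∧ (-tau) ^ 2 + (-tau) * (-tau ^ 2) + (-tau ^ 2) ^ 2 = 0 := by
  have h1 := skeinA_mul_skeinAinv
  have h2 := skeinA_add_skeinAinv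
  exact ⟨by linear_combination h1, by linear_combination (-tau ^ 2) * h2⟩

/-- ★★★ **KAUFFMAN'S GENERATOR AT THE CLOSING EDGE, AFTER THE ROTATION, ON THE PLANAR MODULE AT THE PERCOLATION POINT**: `tlBmod = g_{*,0} ∘ ρ` with
`g = (−τ)·1 + (−τ²)·e_{*,0} = A⁻¹·1 + A·e` (`A = −τ²`), i.e. `kauffmanGen (tlLper 1) (−τ) (−τ²) (last) * lpRotL`.
[cite: Kauffman1991KnotsPhysics, Part I §7: ρ(σᵢ) = A + A⁻¹Uᵢ, Prop. 7.5; PearceRittenbergDeGierNienhuis2002, §2 (TL); KhristoforovSmirnov2021, §1.2 (arXiv v1 p. 2)] -/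
noncomputable def tlBmod : Module.End ℂ (LinkPattern (n + 1 + 1) →₀ ℂ) :=
  kauffmanGen (tlLper (n := n) ℂ 1) (-tau) (-tau ^ 2) (Fin.last (n + 1)) * lpRotL ℂ

/-- `tlBmod` on a basis vector: `δ_P ↦ (−τ)·δ_{ρP} + (−τ²)·δ_{e_{*,0} ρP}`. [cite: Kauffman1991KnotsPhysics, Part I §7 Prop. 7.5; KhristoforovSmirnov2021, §1.2 (arXiv v1 p. 2)] -/
theorem tlBmod_single (P : LinkPattern (n + 1 + 1)) :
    tlBmod (Finsupp.single P 1) = (-tau) • Finsupp.single (lpRot P) 1 + (-tau ^ 2) • Finsupp.single (lpCapRot P) 1 := by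
  rw [tlBmod, Module.End.mul_apply, lpRotL_single, kauffmanGen_apply, tlLper_last, tlLcap_single]
  simp only [ite_self, one_smul]
  rfl

/-- ★★★ **THE LANE'S `tlBraid` IS THE TRANSPOSE OF `tlBmod`**: `tlBraid φ P = ⟪φ, tlBmod δ_P⟫ = Σ_Q (tlBmod δ_P)(Q)·φ(Q)` — so, by `solWLinkEquiv_solWRot`, THE RELABELLING
ROTATION OF KHRISTOFOROV–SMIRNOV'S `k` MARKS IS THE TRANSPOSE OF KAUFFMAN'S GENERATOR `A⁻¹·1 + A·e_{*,0}` AT THE CLOSING EDGE COMPOSED WITH THE POLYGON ROTATION,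
literally in terms of `kauffmanGen`. [cite: KhristoforovSmirnov2021, §2 Lemma 4 (arXiv v1 p. 4); §1.2 (p. 2); Kauffman1991KnotsPhysics, Part I §7 Prop. 7.5; PearceRittenbergDeGierNienhuis2002, §2 (TL)] -/
theorem tlBraid_eq_linearCombination_tlBmod (φ : LinkPattern (n + 1 + 1) → ℂ) (P : LinkPattern (n + 1 + 1)) :
    tlBraid φ P = Finsupp.linearCombination ℂ φ (tlBmod (Finsupp.single P 1)) := by
  rw [tlBmod_single, map_add, map_smul, map_smul, Finsupp.linearCombination_single, Finsupp.linearCombination_single, tlBraid_apply]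
  simp only [smul_eq_mul, one_mul]

/-- ★★ **THE INVERSE: `A·1 + A⁻¹·e_{k−1,*}` AFTER `ρ⁻¹`** on the planar module: `kauffmanGen (tlLper 1) (−τ²) (−τ) (k−1) * lpRotInvL`.
[cite: Kauffman1991KnotsPhysics, Part I §7: ρ(σᵢ⁻¹) = A⁻¹ + AUᵢ, Prop. 7.5; KhristoforovSmirnov2021, §1.2 (arXiv v1 p. 2)] -/
noncomputable def tlBmodInv : Module.End ℂ (LinkPattern (n + 1 + 1) →₀ ℂ) :=
  kauffmanGen (tlLper (n := n) ℂ 1) (-tau ^ 2) (-tau) (Fin.castSucc (Fin.last n)) * lpRotInvL ℂ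

/-- `tlBmodInv` on a basis vector: `δ_P ↦ (−τ²)·δ_{ρ⁻¹P} + (−τ)·δ_{e_{k−1,*} ρ⁻¹P}`. [cite: Kauffman1991KnotsPhysics, Part I §7 Prop. 7.5; KhristoforovSmirnov2021, §1.2 (arXiv v1 p. 2)] -/
theorem tlBmodInv_single (P : LinkPattern (n + 1 + 1)) :
    tlBmodInv (Finsupp.single P 1) = (-tau ^ 2) • Finsupp.single (lpRotInv P) 1 + (-tau) • Finsupp.single (lpCapPred (lpRotInv P)) 1 := by
  rw [tlBmodInv, Module.End.mul_apply, lpRotInvL_single, kauffmanGen_apply, tlLper_castSucc, tlL_single]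
  simp only [ite_self, one_smul]
  rfl

/-- ★★ the lane's `tlBraidInv` is the transpose of `tlBmodInv`. [cite: KhristoforovSmirnov2021, §2 Lemma 4 (arXiv v1 p. 4); Kauffman1991KnotsPhysics, Part I §7 Prop. 7.5] -/
theorem tlBraidInv_eq_linearCombination_tlBmodInv (φ : LinkPattern (n + 1 + 1) → ℂ) (P : LinkPattern (n + 1 + 1)) :
    tlBraidInv φ P = Finsupp.linearCombination ℂ φ (tlBmodInv (Finsupp.single P 1)) := by
  rw [tlBmodInv_single, map_add, map_smul, map_smul, Finsupp.linearCombination_single, Finsupp.linearCombination_single, tlBraidInv_apply]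
  simp only [smul_eq_mul, one_mul]

/-- conjugating the inverse generator through the rotation: `ρ ∘ (A·1 + A⁻¹·e_{k−1,*}) = (A·1 + A⁻¹·e_{*,0}) ∘ ρ`.
[cite: Kauffman1991KnotsPhysics, Part I §7 Prop. 7.5; KhristoforovSmirnov2021, §1.2 (arXiv v1 p. 2)] -/
theorem lpRotL_mul_kauffmanGen_last (a b : ℂ) :
    lpRotL (n := n) ℂ * kauffmanGen (tlLper ℂ 1) a b (Fin.castSucc (Fin.last n)) = kauffmanGen (tlLper ℂ 1) a b (Fin.last (n + 1)) * lpRotL ℂ := by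
  rw [kauffmanGen, kauffmanGen, tlLper_castSucc, tlLper_last, mul_add, add_mul, Algebra.algebraMap_eq_smul_one, smul_mul_assoc, mul_smul_comm, one_mul,
    mul_one, mul_smul_comm, smul_mul_assoc, lpRotL_mul_tlL_last]

/-- the same for the inverse rotation: `(A·1 + A⁻¹·e_{k−1,*}) ∘ ρ⁻¹ = ρ⁻¹ ∘ (A·1 + A⁻¹·e_{*,0})`. [cite: Kauffman1991KnotsPhysics, Part I §7 Prop. 7.5; KhristoforovSmirnov2021, §1.2 (arXiv v1 p. 2)] -/
theorem kauffmanGen_castSucc_mul_lpRotInvL (a b : ℂ) :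
    kauffmanGen (tlLper ℂ 1) a b (Fin.castSucc (Fin.last n)) * lpRotInvL (n := n) ℂ = lpRotInvL ℂ * kauffmanGen (tlLper ℂ 1) a b (Fin.last (n + 1)) := by
  have h := lpRotL_mul_kauffmanGen_last (n := n) a b
  have h1 := lpRotL_mul_lpRotInvL (n := n) ℂ
  have h2 := lpRotInvL_mul_lpRotL (n := n) ℂ
  calc kauffmanGen (tlLper ℂ 1) a b (Fin.castSucc (Fin.last n)) * lpRotInvL ℂ
      = lpRotInvL ℂ * (lpRotL ℂ * kauffmanGen (tlLper ℂ 1) a b (Fin.castSucc (Fin.last n))) * lpRotInvL ℂ := by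
        rw [← mul_assoc, h2, one_mul]
    _ = lpRotInvL ℂ * kauffmanGen (tlLper ℂ 1) a b (Fin.last (n + 1)) := by rw [h, mul_assoc, mul_assoc, h1, mul_one]

/-- the closing-edge generator is idempotent at loop weight one. [cite: PearceRittenbergDeGierNienhuis2002, §2 (TL) at q + q⁻¹ = 1] -/
theorem tlLper_one_last_idem : tlLper (n := n) ℂ 1 (Fin.last (n + 1)) * tlLper ℂ 1 (Fin.last (n + 1)) = tlLper ℂ 1 (Fin.last (n + 1)) := by
  rw [tlLper_last, tlLcap_mul_tlLcap, one_smul]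

/-- ★★ **KAUFFMAN UNITARITY ON THE MODULE SIDE, I**: `tlBmod * tlBmodInv = 1` — from `TemperleyLiebBraid.kauffman_mul_eq_one_of_one` ((u + ve)(v + ue) = 1 for uv = 1,
u² + uv + v² = 0, e² = e) after conjugating `e_{k−1,*}` into `e_{*,0}` by the rotation. [cite: Kauffman1991KnotsPhysics, Part I §7 Prop. 7.5, proof step «First»; KhristoforovSmirnov2021, §1.2 (arXiv v1 p. 2)] -/
theorem tlBmod_mul_tlBmodInv : tlBmod (n := n) * tlBmodInv = 1 := by
  obtain ⟨huv, hq⟩ := tau_criterion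
  rw [tlBmod, tlBmodInv, mul_assoc, ← mul_assoc (lpRotL ℂ), lpRotL_mul_kauffmanGen_last, mul_assoc, lpRotL_mul_lpRotInvL, mul_one]
  exact kauffman_mul_eq_one_of_one tlLper_one_last_idem huv hq

/-- ★★ **KAUFFMAN UNITARITY ON THE MODULE SIDE, II**: `tlBmodInv * tlBmod = 1`. [cite: Kauffman1991KnotsPhysics, Part I §7 Prop. 7.5, proof step «First»; KhristoforovSmirnov2021, §1.2 (arXiv v1 p. 2)] -/
theorem tlBmodInv_mul_tlBmod : tlBmodInv (n := n) * tlBmod = 1 := by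
  obtain ⟨huv, hq⟩ := tau_criterion
  have hq' : (-tau ^ 2) ^ 2 + (-tau ^ 2) * (-tau) + (-tau) ^ 2 = 0 := by linear_combination hq
  have huv' : (-tau ^ 2) * (-tau) = 1 := by linear_combination huv
  rw [tlBmod, tlBmodInv, kauffmanGen_castSucc_mul_lpRotInvL]
  calc lpRotInvL ℂ * kauffmanGen (tlLper ℂ 1) (-tau ^ 2) (-tau) (Fin.last (n + 1)) * (kauffmanGen (tlLper ℂ 1) (-tau) (-tau ^ 2) (Fin.last (n + 1)) * lpRotL ℂ)
      = lpRotInvL ℂ * (kauffmanGen (tlLper ℂ 1) (-tau ^ 2) (-tau) (Fin.last (n + 1)) * kauffmanGen (tlLper ℂ 1) (-tau) (-tau ^ 2) (Fin.last (n + 1))) * lpRotL ℂ := by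
        simp only [mul_assoc]
    _ = 1 := by
        rw [show kauffmanGen (tlLper ℂ 1) (-tau ^ 2) (-tau) (Fin.last (n + 1)) * kauffmanGen (tlLper ℂ 1) (-tau) (-tau ^ 2) (Fin.last (n + 1)) = 1 from
          kauffman_mul_eq_one_of_one tlLper_one_last_idem huv' hq', mul_one, lpRotInvL_mul_lpRotL]

/-! ### Transposition extended linearly; the full twist on the planar module -/

/-- ★ **TRANSPOSITION, LINEARLY**: `⟪tlBraid φ, x⟫ = ⟪φ, tlBmod x⟫` for every vector `x` of the planar module (`⟪φ, x⟫ = Σ_Q x(Q)·φ(Q)`).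
[cite: KhristoforovSmirnov2021, §2 Lemma 4 (arXiv v1 p. 4); Kauffman1991KnotsPhysics, Part I §7 Prop. 7.5] -/
theorem linearCombination_tlBraid (φ : LinkPattern (n + 1 + 1) → ℂ) (x : LinkPattern (n + 1 + 1) →₀ ℂ) :
    Finsupp.linearCombination ℂ (tlBraid φ) x = Finsupp.linearCombination ℂ φ (tlBmod x) := by
  have h : (Finsupp.linearCombination ℂ (tlBraid φ) : (LinkPattern (n + 1 + 1) →₀ ℂ) →ₗ[ℂ] ℂ) =
      Finsupp.linearCombination ℂ φ ∘ₗ (tlBmod : Module.End ℂ (LinkPattern (n + 1 + 1) →₀ ℂ)) := by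
    refine Finsupp.lhom_ext fun P c => ?_
    rw [LinearMap.comp_apply, ← mul_one c, ← smul_eq_mul, ← Finsupp.smul_single, map_smul, map_smul, map_smul, Finsupp.linearCombination_single, one_smul,
      tlBraid_eq_linearCombination_tlBmod]
  exact LinearMap.congr_fun h x

/-- ★ the same for all powers: `((tlBraid)^m φ)(P) = ⟪φ, tlBmod^m δ_P⟫`. [cite: KhristoforovSmirnov2021, §1.2 (arXiv v1 p. 2: cyclic indexing); Kauffman1991KnotsPhysics, Part I §7 Prop. 7.5] -/
theorem tlBraid_pow_eq_linearCombination (m : ℕ) (φ : LinkPattern (n + 1 + 1) → ℂ) (P : LinkPattern (n + 1 + 1)) :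
    ((tlBraid : Module.End ℂ (LinkPattern (n + 1 + 1) → ℂ)) ^ m) φ P = Finsupp.linearCombination ℂ φ ((tlBmod ^ m) (Finsupp.single P 1)) := by
  induction m generalizing φ with
  | zero => rw [pow_zero, pow_zero, Module.End.one_apply, Module.End.one_apply, Finsupp.linearCombination_single, one_smul]
  | succ m ih => rw [pow_succ, Module.End.mul_apply, ih (tlBraid φ), linearCombination_tlBraid, pow_succ', Module.End.mul_apply]

/-- pairing with the indicator of `Q` reads off the `Q`-coefficient. [folklore] -/
private theorem linearCombination_indicator (Q : LinkPattern (n + 1 + 1)) (x : LinkPattern (n + 1 + 1) →₀ ℂ) :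
    Finsupp.linearCombination ℂ (fun R => if R = Q then (1 : ℂ) else 0) x = x Q := by
  rw [Finsupp.linearCombination_apply, Finsupp.sum]
  simp only [smul_eq_mul, mul_ite, mul_one, mul_zero, Finset.sum_ite_eq', Finsupp.mem_support_iff, ne_eq, ite_not]
  split_ifs with h
  · exact h.symm
  · rfl

/-- ★★ **THE FULL TWIST IS TRIVIAL ON THE PLANAR MODULE**: `tlBmod ^ k = 1` (`k = n+1` marks) — the module-side transpose of #528's `tlBraid_pow_marks`.
[cite: Kauffman1991KnotsPhysics, Part I §7 Prop. 7.5; KhristoforovSmirnov2021, §1.2 (arXiv v1 p. 2: cyclic indexing, rot^k = id)] -/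
theorem tlBmod_pow_marks : (tlBmod : Module.End ℂ (LinkPattern (n + 1 + 1) →₀ ℂ)) ^ (n + 1) = 1 := by
  refine Finsupp.lhom_ext fun P c => ?_
  rw [Module.End.one_apply, ← mul_one c, ← smul_eq_mul, ← Finsupp.smul_single, map_smul]
  congr 1
  ext Q
  rw [← linearCombination_indicator Q, ← tlBraid_pow_eq_linearCombination, tlBraid_pow_marks, Module.End.one_apply, Finsupp.single_apply]

/-- ★ **the inverse is the `(k−1)`-st power on the module side too**: `tlBmodInv = tlBmod ^ (k−1)`. [cite: Kauffman1991KnotsPhysics, Part I §7 Prop. 7.5; KhristoforovSmirnov2021, §1.2 (arXiv v1 p. 2)] -/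
theorem tlBmodInv_eq_pow : (tlBmodInv : Module.End ℂ (LinkPattern (n + 1 + 1) →₀ ℂ)) = tlBmod ^ n := by
  have h : (tlBmod : Module.End ℂ (LinkPattern (n + 1 + 1) →₀ ℂ)) ^ (n + 1) * tlBmodInv = tlBmod ^ n := by
    rw [pow_succ, mul_assoc, tlBmod_mul_tlBmodInv, mul_one]
  rw [tlBmod_pow_marks, one_mul] at h
  exact h

end Braid

end Periodic

end Literature.Probability.Percolation.MarkedLoops
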